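import Literature.NumberTheory.Automorphic.SupercuspidalTestFunctions
import Literature.NumberTheory.Automorphic.AutomorphicQuotientKernelConvolution
import HarnessLib

/-!
# Supercusp forms are a two-sided ideal for convolution
(Harish-Chandra, *Harmonic analysis on reductive `p`-adic groups* (1970), §I.3–§I.4: the space of
cusp forms `°𝒜(G)` is stable under left and right convolution by `C_c^∞(G)`; Gelbart,
*Automorphic forms on adele groups* (1975), §10, p. 153: the `*`-algebra generated by the
supercusp forms `f_v`; Jacquet–Langlands, LNM 114 (1970), §16, p. 503)

Topic `NumberTheory/Automorphic`; theorems only (no definition, no named fact, no instance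
visible to importers). A **supercusp form** on `GL_n(F)` in the sense of the tree
(`SupercuspidalTestFunctions`, `SupercuspFormUnipotentIntegral`) is a function `ξ` with
`∫_{𝔫_k(F)} ξ(a (1 + Y) b) dY = 0` for all `a, b ∈ GL_n(F)` (a block `0 < k < n`, an additive Haar
measure `dY` on `𝔫_k(F)`). For the multiplicative convolution
`(ξ ⋆ ξ')(x) = ∫ ξ(c) ξ'(c⁻¹ x) dμ(c)` of the tree (`mulConv`, left-invariant `μ`) and continuous
compactly supported `ξ`, `ξ'`:

* `integral_mulConv_comp_unipotent_eq_zero_of_left` — **if `ξ` is a supercusp form then so is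
  `ξ ⋆ ξ'`**: `(ξ ⋆ ξ')(x) = ∫ ξ(x d) ξ'(d⁻¹) dμ(d)` (left invariance), so
  `∫ (ξ ⋆ ξ')(a (1+Y) b) dY = ∫ ξ'(d⁻¹) (∫ ξ(a (1+Y) (b d)) dY) dμ(d) = 0` (Fubini over the compactly
  supported continuous integrand on `𝔫_k(F) × GL_n(F)`);
* `integral_mulConv_comp_unipotent_eq_zero_of_right` — **if `ξ'` is a supercusp form then so is
  `ξ ⋆ ξ'`**: `∫ (ξ ⋆ ξ')(a (1+Y) b) dY = ∫ ξ(c) (∫ ξ'((c⁻¹ a) (1+Y) b) dY) dμ(c) = 0`.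

Together with `mulStar_supercuspForm` (`SupercuspidalTwoPlaceLocalComponents`: `ξ^*` is a
supercusp form if `ξ` is, for every additive Haar measure) this shows that the supercusp forms in
`C_c(GL_n(F))` form a `*`-closed two-sided ideal of the convolution algebra — so the product test
functions with a supercusp factor at `v` span `*`-algebras all of whose members are of supercusp
type at `v` (the local factor algebras of the matched algebras in the comparison of trace
formulas, `TraceComparisonDatumOfTestAlgebra`, `ProductGroupConvolution`).

## References

* Harish-Chandra (notes by G. van Dijk), *Harmonic analysis on reductive `p`-adic groups*, LNM 162
  (1970), §I.3–§I.4 [HarishChandra1970].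
* S. Gelbart, *Automorphic forms on adele groups*, Ann. of Math. Studies 83 (1975), §10, p. 153
  [Gelbart1975].
-/

noncomputable section

open MeasureTheory Measure Set Filter Topology
open scoped Pointwise

namespace Literature.NumberTheory.Automorphic

section Ideal

variable {F : Type*} [Field F] [TopologicalSpace F] [IsTopologicalRing F] [T2Space F] {n k : ℕ}
  [MeasurableSpace (GL (Fin n) F)] [BorelSpace (GL (Fin n) F)] [SecondCountableTopology (GL (Fin n) F)]
  [MeasurableSpace (blockNilpotent n k F)] [BorelSpace (blockNilpotent n k F)]

omit [MeasurableSpace (GL (Fin n) F)] [BorelSpace (GL (Fin n) F)] [SecondCountableTopology (GL (Fin n) F)]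
  [MeasurableSpace (blockNilpotent n k F)] [BorelSpace (blockNilpotent n k F)] [T2Space F] in
/-- `Y ↦ 1 + Y` is continuous from `𝔫_k(F)` to `GL_n(F)`. [folklore] -/
theorem continuous_unipotentOfBlock_ofAdd_field :
    Continuous fun Y : blockNilpotent n k F => unipotentOfBlock n k F (Multiplicative.ofAdd Y) := by
  refine Units.continuous_iff.2 ⟨?_, ?_⟩
  · exact continuous_const.add continuous_subtype_val
  · exact continuous_const.sub continuous_subtype_val

/-- **A left supercusp factor makes the convolution a supercusp form**: if
`∫ ξ(a (1+Y) b) dY = 0` for all `a, b` then `∫ (ξ ⋆ ξ')(a (1+Y) b) dY = 0` for all `a, b`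
(`μ` left invariant; `ξ`, `ξ'` continuous with compact support).
[cite: HarishChandra1970, §I.3] -/
theorem integral_mulConv_comp_unipotent_eq_zero_of_left
    (μ : Measure (GL (Fin n) F)) [IsFiniteMeasureOnCompacts μ] [SFinite μ] [μ.IsMulLeftInvariant]
    (α : Measure (blockNilpotent n k F)) [IsFiniteMeasureOnCompacts α] [SFinite α]
    {ξ ξ' : GL (Fin n) F → ℂ} (hξ : Continuous ξ) (hξs : HasCompactSupport ξ)
    (hξ' : Continuous ξ') (hξ's : HasCompactSupport ξ')
    (h0 : ∀ a b : GL (Fin n) F, ∫ Y, ξ (a * unipotentOfBlock n k F (Multiplicative.ofAdd Y) * b) ∂α = 0)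
    (a b : GL (Fin n) F) :
    ∫ Y, mulConv μ ξ ξ' (a * unipotentOfBlock n k F (Multiplicative.ofAdd Y) * b) ∂α = 0 := by
  haveI : T2Space (Matrix (Fin n) (Fin n) F) := inferInstanceAs (T2Space (Fin n → Fin n → F))
  -- `(ξ ⋆ ξ')(x) = ∫ ξ(x d) ξ'(d⁻¹) dμ(d)`
  have step : ∀ x : GL (Fin n) F, mulConv μ ξ ξ' x = ∫ d, ξ (x * d) * ξ' d⁻¹ ∂μ := by
    intro x
    rw [mulConv_apply, ← integral_mul_left_eq_self (fun c => ξ c * ξ' (c⁻¹ * x)) x]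
    congr 1 with d
    rw [mul_inv_rev, inv_mul_cancel_right]
  simp_rw [step]
  -- the joint integrand is continuous with compact support
  set G : blockNilpotent n k F → GL (Fin n) F → ℂ := fun Y d =>
    ξ (a * unipotentOfBlock n k F (Multiplicative.ofAdd Y) * b * d) * ξ' d⁻¹ with hG
  have hGc : Continuous (Function.uncurry G) :=
    (hξ.comp (((continuous_const.mul (continuous_unipotentOfBlock_ofAdd_field.comp continuous_fst)).mul
      continuous_const).mul continuous_snd)).mul (hξ'.comp continuous_snd.inv)
  set Sd : Set (GL (Fin n) F) := (tsupport ξ')⁻¹ with hSd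
  have hSdc : IsCompact Sd := hξ's.isCompact.inv
  set C : Set (GL (Fin n) F) := {a⁻¹} * tsupport ξ * ({b} * Sd)⁻¹ with hC
  have hCc : IsCompact C :=
    (isCompact_singleton.mul hξs.isCompact).mul (isCompact_singleton.mul hSdc).inv
  set SY : Set (blockNilpotent n k F) :=
    {Y | unipotentOfBlock n k F (Multiplicative.ofAdd Y) ∈ C} with hSY
  have hSYc : IsCompact SY := isCompact_preimage_unipotentOfBlock hCc
  have hGs : HasCompactSupport (Function.uncurry G) := by
    refine HasCompactSupport.intro (hSYc.prod hSdc) fun p hp => ?_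
    rcases p with ⟨Y, d⟩
    change ξ (a * unipotentOfBlock n k F (Multiplicative.ofAdd Y) * b * d) * ξ' d⁻¹ = 0
    by_contra hne
    have h1 : ξ (a * unipotentOfBlock n k F (Multiplicative.ofAdd Y) * b * d) ≠ 0 := fun h =>
      hne (by rw [h, zero_mul])
    have h2 : ξ' d⁻¹ ≠ 0 := fun h => hne (by rw [h, mul_zero])
    have hd : d ∈ Sd := by
      rw [hSd, Set.mem_inv]
      exact subset_tsupport _ h2
    have hY : Y ∈ SY := by
      change unipotentOfBlock n k F (Multiplicative.ofAdd Y) ∈ C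
      have ht : a * unipotentOfBlock n k F (Multiplicative.ofAdd Y) * b * d ∈ tsupport ξ := subset_tsupport _ h1
      have heq : unipotentOfBlock n k F (Multiplicative.ofAdd Y) =
          a⁻¹ * (a * unipotentOfBlock n k F (Multiplicative.ofAdd Y) * b * d) * (b * d)⁻¹ := by group
      rw [heq]
      exact Set.mul_mem_mul (Set.mul_mem_mul rfl ht) (Set.inv_mem_inv.2 (Set.mul_mem_mul rfl hd))
    exact hp ⟨hY, hd⟩
  have hint : Integrable (Function.uncurry G) (α.prod μ) := hGc.integrable_of_hasCompactSupport hGs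
  rw [integral_integral_swap hint]
  -- the inner integral vanishes for every `d`
  have hinner : ∀ d : GL (Fin n) F, ∫ Y, G Y d ∂α = 0 := by
    intro d
    simp only [hG]
    rw [integral_mul_const]
    have h := h0 a (b * d)
    simp only [← mul_assoc] at h
    rw [h, zero_mul]
  simp_rw [hinner]
  exact integral_zero _ _

/-- **A right supercusp factor makes the convolution a supercusp form**: if
`∫ ξ'(a (1+Y) b) dY = 0` for all `a, b` then `∫ (ξ ⋆ ξ')(a (1+Y) b) dY = 0` for all `a, b`.
[cite: HarishChandra1970, §I.3] -/
theorem integral_mulConv_comp_unipotent_eq_zero_of_right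
    (μ : Measure (GL (Fin n) F)) [IsFiniteMeasureOnCompacts μ] [SFinite μ]
    (α : Measure (blockNilpotent n k F)) [IsFiniteMeasureOnCompacts α] [SFinite α]
    {ξ ξ' : GL (Fin n) F → ℂ} (hξ : Continuous ξ) (hξs : HasCompactSupport ξ)
    (hξ' : Continuous ξ') (hξ's : HasCompactSupport ξ')
    (h0 : ∀ a b : GL (Fin n) F, ∫ Y, ξ' (a * unipotentOfBlock n k F (Multiplicative.ofAdd Y) * b) ∂α = 0)
    (a b : GL (Fin n) F) :
    ∫ Y, mulConv μ ξ ξ' (a * unipotentOfBlock n k F (Multiplicative.ofAdd Y) * b) ∂α = 0 := by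
  haveI : T2Space (Matrix (Fin n) (Fin n) F) := inferInstanceAs (T2Space (Fin n → Fin n → F))
  simp_rw [mulConv_apply]
  set G : blockNilpotent n k F → GL (Fin n) F → ℂ := fun Y c =>
    ξ c * ξ' (c⁻¹ * (a * unipotentOfBlock n k F (Multiplicative.ofAdd Y) * b)) with hG
  have hGc : Continuous (Function.uncurry G) :=
    (hξ.comp continuous_snd).mul (hξ'.comp (continuous_snd.inv.mul
      ((continuous_const.mul (continuous_unipotentOfBlock_ofAdd_field.comp continuous_fst)).mul
        continuous_const)))
  set Sc : Set (GL (Fin n) F) := tsupport ξ with hSc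
  have hScc : IsCompact Sc := hξs.isCompact
  set C : Set (GL (Fin n) F) := {a⁻¹} * Sc * tsupport ξ' * {b⁻¹} with hC
  have hCc : IsCompact C :=
    ((isCompact_singleton.mul hScc).mul hξ's.isCompact).mul isCompact_singleton
  set SY : Set (blockNilpotent n k F) :=
    {Y | unipotentOfBlock n k F (Multiplicative.ofAdd Y) ∈ C} with hSY
  have hSYc : IsCompact SY := isCompact_preimage_unipotentOfBlock hCc
  have hGs : HasCompactSupport (Function.uncurry G) := by
    refine HasCompactSupport.intro (hSYc.prod hScc) fun p hp => ?_
    rcases p with ⟨Y, c⟩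
    change ξ c * ξ' (c⁻¹ * (a * unipotentOfBlock n k F (Multiplicative.ofAdd Y) * b)) = 0
    by_contra hne
    have h1 : ξ c ≠ 0 := fun h => hne (by rw [h, zero_mul])
    have h2 : ξ' (c⁻¹ * (a * unipotentOfBlock n k F (Multiplicative.ofAdd Y) * b)) ≠ 0 := fun h =>
      hne (by rw [h, mul_zero])
    have hc : c ∈ Sc := subset_tsupport _ h1
    have hY : Y ∈ SY := by
      change unipotentOfBlock n k F (Multiplicative.ofAdd Y) ∈ C
      have ht : c⁻¹ * (a * unipotentOfBlock n k F (Multiplicative.ofAdd Y) * b) ∈ tsupport ξ' :=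
        subset_tsupport _ h2
      have heq : unipotentOfBlock n k F (Multiplicative.ofAdd Y) =
          a⁻¹ * c * (c⁻¹ * (a * unipotentOfBlock n k F (Multiplicative.ofAdd Y) * b)) * b⁻¹ := by group
      rw [heq]
      exact Set.mul_mem_mul (Set.mul_mem_mul (Set.mul_mem_mul rfl hc) ht) rfl
    exact hp ⟨hY, hc⟩
  have hint : Integrable (Function.uncurry G) (α.prod μ) := hGc.integrable_of_hasCompactSupport hGs
  rw [integral_integral_swap hint]
  have hinner : ∀ c : GL (Fin n) F, ∫ Y, G Y c ∂α = 0 := by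
    intro c
    simp only [hG]
    rw [integral_const_mul]
    have h := h0 (c⁻¹ * a) b
    simp only [mul_assoc] at h ⊢
    rw [h, mul_zero]
  simp_rw [hinner]
  exact integral_zero _ _

end Ideal

end Literature.NumberTheory.Automorphic
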